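import Summits.QuantumFields.YangMills.Theorems.BalabanUVNodesN15DerivDefectMajorant

/-!
# Route «BalabanUVNodes» (K4 «SpineRates»), node N15 = NE2, BACKGROUND LAYER — THE COEFFICIENT COMMUTATOR: the adjoint-derivative entry of a fine
# left factor TIMES A COEFFICIENT, `(T′∘M_{a′})∘∇′*`, from `T′`'s own adjoint-derivative entry and one bond difference of the coefficient

Cell `pub-ymgap`, seat `pub-ymgap-dag-n15-b` (D-0062; `bears_on: R4∕N15`; `--supports stmt-QuantumFields-19351 --as helper`).  THEOREMS ONLY; imports this seat's
part 2 `…N15DerivDefectMajorant` (p409836 ✓) BY NAME.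

THE POINT.  The sandwiched first-order defect (`…N15FirstOrderDefect.hasMaj_comp_idef_firstOrder_comp`, p410747; HONEST LIMIT (b) of part 1) takes as a
binder the adjoint-derivative entry of the COMPOSITE left factor `S′ = T′∘M_{a′}` — the fine propagator times the perturbation's coefficient — whereas
print bounds the entry of the propagator itself ([Balaban1985BackgroundPropagators] Thm 3.1 (3.42) p. 397, third entry *«|(G′∇*_U λ)(x)|»*) and the
coefficient by (3.35) p. 396 (*«|A| < O(1)Mα₀(L^jη)^{−1}, |∇^ηA| < O(1)Mα₀(L^jη)^{−2}»*).  The gap between the two is ONE EXACT COMMUTATOR: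
`M_a ∘ ∇* = ∇* ∘ M_a + M_{a − a∘s⁻¹} ∘ (shift by s⁻¹)` (`mulOp_comp_bdiff`) — the coefficient passes through the adjoint difference at the price of its own
backward bond difference.  Hence (`hasMaj_comp_mulOp_bdiffN`): from `T′∘∇′*_{η′} ≤ N₃` (SHAPE (3.42)₃), `T′ ≤ N_T`, the coefficient size `|a′| ≤ α` and
bond-difference quotient `|η′⁻¹(a′ − a′∘s′⁻¹)| ≤ G` (SHAPES (3.35)), and a majorant `K_sh` of the fine unit shift between the fine cube norms (geometric
plumbing: which cubes a unit step can reach), the composite's entry is `≤ α·N₃ + G·(N_T ⋆ K_sh)` — binder `hS` of part 4 from printed-shape letters only.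

CONTENTS ([folklore]; 1 plumbing def).  §1 `mulOp_comp_bdiff`, `mulOp_comp_bdiffN`, `comp_mulOp_comp_bdiffN` (exact); §2 `hasMaj_mulOp_fine` (diagonal majorant of
a fine coefficient, `T4EtaRateCoeffDefect.hasMaj_mulOp` re-read), `hasMaj_comp_mulOp_bdiffN` (THE ESTIMATE); §3 `shiftKernel` + `hasMaj_pull_symm` (the shift
majorant `K_sh` DISCHARGED from block-line data: the inverse fine shift reaches only the same cube and the coarse-shift neighbour's cube).

HONEST FRAMING ∕ LIMITS.  MECHANISM ONLY over binders; (3.42)₃ and (3.35) are SHAPES; the shift majorant `K_sh` is data; nothing of [B9] asserted.  NE2⁺ NOT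
PRINTED, NOT proved; count-neutral (typed 28∕28 · discharged 0∕28); one finite T⁴ at fixed ε — NOT infinite volume, NOT OS on ℝ⁴, NOT a mass gap, NOT Clay.
-/

noncomputable section

namespace Summit.QuantumFields.YangMills.BalabanUVNodes.N15.DerivDefect

open Literature.MathematicalPhysics.QuantumFieldTheory.Balaban1983to89
open Literature.MathematicalPhysics.QuantumFieldTheory.Balaban1983to89.B11SectG (BlockNorm HasMaj hasMaj_comp)
open Literature.MathematicalPhysics.QuantumFieldTheory.Balaban1983to89.T4EtaRateCoeffDefect (pull pull_apply diagK diagK_nonneg hasMaj_mulOp)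
open Literature.MathematicalPhysics.QuantumFieldTheory.Balaban1983to89.B6Prop26Gluing (mulOp mulOp_apply)

/-! ## §1 The exact commutator of a coefficient with the adjoint difference -/

section Exact

variable {X : Type}

/-- **THE COMMUTATOR**: `M_a ∘ ∇* = ∇* ∘ M_a + M_{a − a∘s⁻¹} ∘ (pull s⁻¹)` — a coefficient passes through the backward difference at the price of
its own backward bond difference, read after the shift. [folklore] -/
theorem mulOp_comp_bdiff (s : X ≃ X) (a : X → ℝ) :
    mulOp a ∘ₗ bdiff s = bdiff s ∘ₗ mulOp a + mulOp (a - a ∘ s.symm) ∘ₗ pull s.symm := by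
  ext g x
  simp only [LinearMap.comp_apply, mulOp_apply, bdiff_apply, LinearMap.add_apply, Pi.add_apply, Pi.sub_apply, Function.comp_apply,
    pull_apply]
  ring

/-- The same for the difference QUOTIENTS: `M_a ∘ ∇*_η = ∇*_η ∘ M_a + M_{η⁻¹(a − a∘s⁻¹)} ∘ (pull s⁻¹)`. [folklore] -/
theorem mulOp_comp_bdiffN (η : ℝ) (s : X ≃ X) (a : X → ℝ) :
    mulOp a ∘ₗ bdiffN η s = bdiffN η s ∘ₗ mulOp a + mulOp (η⁻¹ • (a - a ∘ s.symm)) ∘ₗ pull s.symm := by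
  ext g x
  simp only [LinearMap.comp_apply, mulOp_apply, bdiffN_apply, LinearMap.add_apply, Pi.add_apply, Pi.sub_apply, Pi.smul_apply,
    Function.comp_apply, pull_apply, smul_eq_mul]
  ring

/-- Inside a composite: `(T′∘M_{a′})∘∇′*_{η′} = (T′∘∇′*_{η′})∘M_{a′} + T′∘M_{η′⁻¹(a′ − a′∘s′⁻¹)}∘(pull s′⁻¹)`. [folklore] -/
theorem comp_mulOp_comp_bdiffN {F : Type} [AddCommGroup F] [Module ℝ F] (T' : (X → ℝ) →ₗ[ℝ] F) (η' : ℝ) (s' : X ≃ X)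
    (a' : X → ℝ) :
    (T' ∘ₗ mulOp a') ∘ₗ bdiffN η' s' =
      (T' ∘ₗ bdiffN η' s') ∘ₗ mulOp a' + T' ∘ₗ (mulOp (η'⁻¹ • (a' - a' ∘ s'.symm)) ∘ₗ pull s'.symm) := by
  rw [LinearMap.comp_assoc, mulOp_comp_bdiffN, LinearMap.comp_add, ← LinearMap.comp_assoc]

end Exact

/-! ## §2 The majorant of the composite's adjoint-derivative entry -/

section Majorant

variable {X' : Type} [Fintype X'] {g : B6.Geometry} (blk' : X' → g.Site)

/-- A fine coefficient of cube-wise size `|c(x′)| ≤ m(blk′ x′)` (`m ≥ 0`) is a diagonal operator of majorant `diagK m` on the fine cube norm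
(`T4EtaRateCoeffDefect.hasMaj_mulOp`). [folklore] -/
theorem hasMaj_mulOp_fine {c : X' → ℝ} {m : g.Site → ℝ} (hm : ∀ y, 0 ≤ m y) (hc : ∀ x', |c x'| ≤ m (blk' x')) :
    HasMaj (BlockNorm.ofBlocks g blk') (BlockNorm.ofBlocks g blk') (mulOp c) (diagK m) :=
  hasMaj_mulOp blk' hm hc

/-- **THE COMPOSITE'S ADJOINT-DERIVATIVE ENTRY FROM PRINTED-SHAPE LETTERS.**  If the fine left factor's own adjoint-derivative entry has a majorant
`N₃ ≥ 0` (`T′∘∇′*_{η′} ≤ N₃`, SHAPE (3.42)₃), `T′ ≤ N_T` (`N_T ≥ 0`), the coefficient has size `|a′| ≤ α` and backward difference quotient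
`|η′⁻¹(a′(x′) − a′(s′⁻¹x′))| ≤ G` (SHAPES (3.35): `α ~ Mα₀(L^jη)⁻¹`, `G ~ Mα₀(L^jη)⁻²`), and the fine unit shift `pull s′⁻¹` has a majorant `K_sh ≥ 0` between
the fine cube norms, then `(T′∘M_{a′})∘∇′*_{η′}` has majorant `α·N₃(y,y′) + G·Σ_{y″} N_T(y,y″)K_sh(y″,y′)` — the binder `hS` of
`…N15FirstOrderDefect.hasMaj_comp_idef_firstOrder_comp`. [cite: Balaban1985BackgroundPropagators, Thm 3.1 (3.42) p.397 + (3.35) p.396 (shapes)] -/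
theorem hasMaj_comp_mulOp_bdiffN {F₃ : Type} [AddCommGroup F₃] [Module ℝ F₃] {b₃ : BlockNorm g F₃}
    {T' : (X' → ℝ) →ₗ[ℝ] F₃} {η' : ℝ} {s' : X' ≃ X'} {a' : X' → ℝ} {N₃ N_T Ksh : g.Site → g.Site → ℝ} {α G : ℝ}
    (hN₃ : ∀ y y', 0 ≤ N₃ y y') (hNT : ∀ y y', 0 ≤ N_T y y') (hα : 0 ≤ α) (hG : 0 ≤ G)
    (hS₀ : HasMaj (BlockNorm.ofBlocks g blk') b₃ (T' ∘ₗ bdiffN η' s') N₃) (hT : HasMaj (BlockNorm.ofBlocks g blk') b₃ T' N_T)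
    (hsh : HasMaj (BlockNorm.ofBlocks g blk') (BlockNorm.ofBlocks g blk') (pull s'.symm) Ksh)
    (ha : ∀ x', |a' x'| ≤ α) (hda : ∀ x', |η'⁻¹ * (a' x' - a' (s'.symm x'))| ≤ G) :
    HasMaj (BlockNorm.ofBlocks g blk') b₃ ((T' ∘ₗ mulOp a') ∘ₗ bdiffN η' s')
      (fun y y' => α * N₃ y y' + G * ∑ y'', N_T y y'' * Ksh y'' y') := by
  rw [comp_mulOp_comp_bdiffN]
  have hκ : (BlockNorm.ofBlocks g blk').κ = 1 := rfl
  -- first piece: (T′∇′*) ∘ M_{a′}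
  have h1 : HasMaj (BlockNorm.ofBlocks g blk') b₃ ((T' ∘ₗ bdiffN η' s') ∘ₗ mulOp a') (fun y y' => α * N₃ y y') := by
    have hm := hasMaj_mulOp_fine blk' (m := fun _ => α) (fun _ => hα) (fun x' => ha x')
    refine (hasMaj_comp hS₀ hm hN₃).mono fun y y' => le_of_eq ?_
    simp only [hκ, one_mul]
    rw [sum_mul_diagK]
    ring
  -- second piece: T′ ∘ M_{∇⁻a′} ∘ shift
  have h2 : HasMaj (BlockNorm.ofBlocks g blk') b₃ (T' ∘ₗ (mulOp (η'⁻¹ • (a' - a' ∘ s'.symm)) ∘ₗ pull s'.symm))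
      (fun y y' => G * ∑ y'', N_T y y'' * Ksh y'' y') := by
    have hm : HasMaj (BlockNorm.ofBlocks g blk') (BlockNorm.ofBlocks g blk') (mulOp (η'⁻¹ • (a' - a' ∘ s'.symm)))
        (diagK fun _ => G) :=
      hasMaj_mulOp_fine blk' (fun _ => hG) fun x' => by
        simpa only [Pi.smul_apply, Pi.sub_apply, Function.comp_apply, smul_eq_mul] using hda x'
    have hin := hasMaj_comp hm hsh (diagK_nonneg fun _ => hG)
    have hin' : HasMaj (BlockNorm.ofBlocks g blk') (BlockNorm.ofBlocks g blk') (mulOp (η'⁻¹ • (a' - a' ∘ s'.symm)) ∘ₗ pull s'.symm)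
        (fun y y' => G * Ksh y y') := by
      refine hin.mono fun y y' => le_of_eq ?_
      simp only [hκ, one_mul]
      exact sum_diagK_mul _ _ _
    refine (hasMaj_comp hT hin' hNT).mono fun y y' => le_of_eq ?_
    simp only [hκ, one_mul]
    rw [Finset.mul_sum]
    exact Finset.sum_congr rfl fun y'' _ => by ring
  exact h1.add h2

end Majorant

/-! ## §3 The shift majorant from block-line data -/

section Shift

variable {X X' : Type} [Fintype X] [Fintype X'] {g : B6.Geometry} (D : LineData X X') (blk : X → g.Site)

open Classical in
/-- THE SHIFT KERNEL of block-line data: `K_sh(y, y′) = 1` if `y = y′` or some coarse site `x` of the cube `y′` steps (by the coarse shift `s`) into the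
cube `y`, else `0` — which fine cubes the inverse fine shift can reach. [folklore] -/
def shiftKernel (y y' : g.Site) : ℝ := if y = y' ∨ ∃ x : X, blk x = y' ∧ blk (D.s x) = y then 1 else 0

omit [Fintype X'] in
/-- The shift kernel is non-negative. [folklore] -/
theorem shiftKernel_nonneg (y y' : g.Site) : 0 ≤ shiftKernel D blk y y' := by
  unfold shiftKernel
  split_ifs <;> norm_num

/-- **THE FINE INVERSE SHIFT HAS THE MAJORANT `K_sh`** between the fine cube norms `ofBlocks g (blk ∘ π)`: a function localised in the fine cube `y′` is
moved by `pull s′⁻¹` into the cubes `y′` (below the face the block is kept) and `blk(s(πu′))` (on the face the next block is entered) only. [folklore] -/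
theorem hasMaj_pull_symm :
    HasMaj (BlockNorm.ofBlocks g (blk ∘ D.π)) (BlockNorm.ofBlocks g (blk ∘ D.π)) (pull D.s'.symm) (shiftKernel D blk) := by
  classical
  intro y' μ hμ y
  have hμ' : ∀ u' : X', blk (D.π u') ≠ y' → μ u' = 0 := hμ
  have hloc0 : 0 ≤ (BlockNorm.ofBlocks g (blk ∘ D.π)).loc y' μ := (BlockNorm.ofBlocks g (blk ∘ D.π)).loc_nonneg y' μ
  refine Literature.MathematicalPhysics.QuantumFieldTheory.Balaban1983to89.B11AxialTransport190.loc_ofBlocks_le (blk ∘ D.π) _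
    (mul_nonneg (shiftKernel_nonneg D blk y y') hloc0) fun x' hx' => ?_
  rw [pull_apply]
  set u' := D.s'.symm x' with hu'
  have hx'u : x' = D.s' u' := by rw [hu', Equiv.apply_symm_apply]
  by_cases hμ0 : μ u' = 0
  · rw [hμ0, abs_zero]
    exact mul_nonneg (shiftKernel_nonneg D blk y y') hloc0
  · have hy' : blk (D.π u') = y' := by
      by_contra hne
      exact hμ0 (hμ' u' hne)
    have hK : shiftKernel D blk y y' = 1 := by
      have hcases : y = y' ∨ ∃ x : X, blk x = y' ∧ blk (D.s x) = y := by
        have hy : blk (D.π x') = y := hx'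
        by_cases hface : D.dep u' + 1 = D.M
        · right
          refine ⟨D.π u', hy', ?_⟩
          rw [← D.π_succ_of_eq u' hface, ← hx'u, hy]
        · left
          rw [← hy, hx'u, D.π_succ_of_lt u' (D.succ_lt_of_ne hface), hy']
      unfold shiftKernel
      rw [if_pos hcases]
    rw [hK, one_mul]
    exact Literature.MathematicalPhysics.QuantumFieldTheory.Balaban1983to89.B11AxialTransport190.abs_le_loc_ofBlocks (blk ∘ D.π) μ hy'

end Shift

end Summit.QuantumFields.YangMills.BalabanUVNodes.N15.DerivDefect
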